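import Literature.NumberTheory.EllipticCurves.PAdicOneVariableSeriesFamilyRelSupply
import Literature.NumberTheory.GaloisRepresentations.LubinTateColemanRelativeGaloisActionLaws
import HarnessLib

/-!
# `p = 2`, CM assembly at the split prime `v`: the `κ_v`-ACTION of `G = Gal(K̄/K(𝔪))` on the `𝔓`-adic norm-coherent
# units `RelNormCoherentUnits hπ E` (`E ≤ K_v^{nr}`), and the series-family hypotheses `hη`/`hgal` for it UNCONDITIONALLY
# (de Shalit II.1.10 Cor., II.4.5–4.6: `G` acts on `𝒰_𝔓` through `Gal(K(𝔪v^∞)_𝔓/Φ) =` image of the local inertia)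

Topic `NumberTheory/EllipticCurves`; namespace `Literature.NumberTheory.EllipticCurves`.

De Shalit II.4.5–4.6: the semi-local units `𝒰 = ∏_𝔓 𝒰_𝔓` of the `𝔭`-division tower over `F = K(𝔪)` form a
`𝒢 = Gal(K(𝔪𝔭^∞)/K)`-module; on one component `𝒰_𝔓` the subgroup `G = Gal(K̄/K(𝔪))` acts through the totally ramified
local group `Gal(Φ_∞/Φ) ≅ 𝒪_𝔭ˣ` (II.1.10 Corollary), i.e. through the character `κ`.  In the tree's currency
(`RelNormCoherentUnits hπ E` along `E·K_π^{m+1} ⊆ K̄_v`, `E ≤ maxUnramified K_v`; global `κ_v = rayAdicCharacter`;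
`res : W_{K_v} → Γ_K`) THIS file CONSTRUCTS that action and discharges the Galois hypotheses of the series-family package for it:

* `rayInertiaLift h𝔪 hv hw g ∈ I_{K_v}` — a local inertia element with `κ_v(res (lift g)) = κ_v g` (choice on
  `exists_mem_inertia_rayAdicCharacter_eq`); `lubinTateChar_rayInertiaLift_mul` (`χ_π(lift (gh)) = χ_π(lift g)·χ_π(lift h)`),
  `lubinTateChar_rayInertiaLift_one`, `lubinTateChar_eq_of_rayAdicCharacter_eq` (inertia elements with the same `κ_v ∘ res`
  have the same `χ_π` — the units junction `unitsMap_integerEquiv_lubinTateChar_eq_inv`);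
* `RelNormCoherentUnits.instCommMonoid` (the termwise product as a `CommMonoid` structure — a `def`, enabled section-locally) and
  ★ `rayAction h𝔪 hv hw hπ E hE : MulDistribMulAction G (RelNormCoherentUnits hπ E)`, **`g • β := (lift g)·β`** (laws from
  `LubinTateColemanRelativeGaloisActionLaws`: the action depends only on `χ_π`, composes, fixes products);
* ★ `hdict_of_exists` — the DICTIONARY hypothesis of `PAdicOneVariableSeriesFamilyRelSupply` for a general `η : B → 𝒰_𝔓`
  follows from the existence of ONE matching inertia element per `(g, b)` (`galAct_congr`);
* ★ `hdict_rayAction` — for `B := RelNormCoherentUnits hπ E` with `rayAction` and `η := id` the dictionary holds BY CONSTRUCTION,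
  hence ★ `seriesFamily_hη_rayAction` / ★ `seriesFamily_hgal_rayAction`: the hypotheses `hη` and `hgal` of
  `PAdicOneVariableSeriesFamilyOf(Rel)NormCoherentUnits` / `…OfCharacter` hold for the `𝔓`-adic units with the `κ_v`-action and
  the character `κ := ((e ∘ §1⁻¹) ∘ κ_v)⁻¹`, with NO dictionary hypothesis left (`hadd` is `map_relTildeSeries_mul`, `hsock` is
  `seriesFamily_hsock_of_relNormCoherentUnits`) — de Shalit's `D_β`, `i(β)` and their moments (p728264/p728641/p729700) are
  thereby defined on `𝒰_𝔓` itself; the Galois dictionary with the GLOBAL elliptic units is needed only inside brick B5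
  (`hrel`/`hcompat` for `β_m(𝔞) = e(𝔞)_𝔓 ∈ 𝒰_𝔓`).

Two definitions with bodies (`rayInertiaLift`, `rayAction`) and one structure-carrying `def` (`instCommMonoid`, used as a
section-local instance); theorems otherwise; no named facts, no global instances, no `sorry`.

## References

* [deShalit1987] E. de Shalit, *Iwasawa theory of elliptic curves with complex multiplication* (1987),
  I.1.8 (p. 11), I.2.3 (iv) (p. 14), I.3.4 Lemma (ii) (p. 18), II.1.10 Corollary (p. 39), II.4.5–4.6 (12)–(14) (p. 58–59).
-/

noncomputable section

open MvPowerSeries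

namespace Literature.NumberTheory.EllipticCurves

section RayAction

open NumberField IsDedekindDomain IsDedekindDomain.HeightOneSpectrum Field ValuativeRel IsLocalRing
open Literature.NumberTheory.GaloisRepresentations Literature.NumberTheory.GaloisRepresentations.IsNonarchimedeanLocalField
  Literature.NumberTheory.GaloisRepresentations.LubinTate Literature.NumberTheory.PAdicHodge
  Literature.NumberTheory.GaloisRepresentations.ArtinLocalGlobal Literature.NumberTheory.NumberFields

variable {K : Type} [Field K] [NumberField K] [IsTotallyComplex K] {𝔪 : Ideal (𝓞 K)} {v : HeightOneSpectrum (𝓞 K)}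
  (h𝔪 : 𝔪 ≠ ⊥) (hv : ¬ 𝔪 ≤ v.asIdeal) (hw : ∀ u : (𝓞 K)ˣ, (u : 𝓞 K) - 1 ∈ 𝔪 → u = 1)

attribute [local instance] ltNormUniformSpace ltNormIsUniformAddGroup rk1 nF nE fintypeResidueField

/-! ### §1. Inertia lifts of `g ∈ Gal(K̄/K(𝔪))` and their Lubin–Tate characters -/

/-- **An inertia lift of `g`**: a local inertia element `w_g ∈ I_{K_v}` with `κ_v(res w_g) = κ_v(g)` (choice on
`exists_mem_inertia_rayAdicCharacter_eq`, THE pinned Artin map). [cite: deShalit1987, II.1.10 Corollary (p. 39)] -/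
def rayInertiaLift (g : ↥(absRestrictNormalHom (rayClassField K 𝔪)).ker) : WeilGroup (v.adicCompletion K) :=
  Classical.choose (exists_mem_inertia_rayAdicCharacter_eq h𝔪 hv hw
    (isLocalArtinMap_canonicalArtin_holds (v.adicCompletion K)) g)

/-- The lift lies in the inertia group. [cite: deShalit1987, II.1.10 Corollary (p. 39)] -/
theorem rayInertiaLift_mem_inertia (g : ↥(absRestrictNormalHom (rayClassField K 𝔪)).ker) :
    rayInertiaLift h𝔪 hv hw g ∈ WeilGroup.inertia (v.adicCompletion K) :=
  (Classical.choose_spec (exists_mem_inertia_rayAdicCharacter_eq h𝔪 hv hw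
    (isLocalArtinMap_canonicalArtin_holds (v.adicCompletion K)) g)).fst

/-- **`κ_v(res w_g) = κ_v(g)`.** [cite: deShalit1987, II.1.10 Corollary (p. 39), II.1.7 (p. 41)] -/
theorem rayAdicCharacter_rayInertiaLift (g : ↥(absRestrictNormalHom (rayClassField K 𝔪)).ker) :
    rayAdicCharacter h𝔪 hv hw ⟨absGaloisRestrict K (v.adicCompletion K)
        (WeilGroup.toAbsGalois (v.adicCompletion K) (rayInertiaLift h𝔪 hv hw g)),
      absGaloisRestrict_toAbsGalois_mem_ker_rayClassField h𝔪 hv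
        (isLocalArtinMap_canonicalArtin_holds (v.adicCompletion K)) (rayInertiaLift_mem_inertia h𝔪 hv hw g)⟩ =
      rayAdicCharacter h𝔪 hv hw g :=
  (Classical.choose_spec (exists_mem_inertia_rayAdicCharacter_eq h𝔪 hv hw
    (isLocalArtinMap_canonicalArtin_holds (v.adicCompletion K)) g)).snd

variable {π : 𝒪[v.adicCompletion K]} (hπ : (valuation (v.adicCompletion K)).IsUniformizer (π : v.adicCompletion K))

/-- **Inertia elements with the same `κ_v ∘ res` have the same Lubin–Tate character** (any uniformiser `π`): the units
junction `χ_π(w) = §1⁻¹(κ_v(res w))⁻¹`. [cite: deShalit1987, II.1.7 (p. 41), II.4.3 (p. 57)] -/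
theorem lubinTateChar_eq_of_rayAdicCharacter_eq {w w' : WeilGroup (v.adicCompletion K)}
    (hwI : w ∈ WeilGroup.inertia (v.adicCompletion K)) (hwI' : w' ∈ WeilGroup.inertia (v.adicCompletion K))
    (h : rayAdicCharacter h𝔪 hv hw ⟨absGaloisRestrict K (v.adicCompletion K)
          (WeilGroup.toAbsGalois (v.adicCompletion K) w),
        absGaloisRestrict_toAbsGalois_mem_ker_rayClassField h𝔪 hv
          (isLocalArtinMap_canonicalArtin_holds (v.adicCompletion K)) hwI⟩ =
      rayAdicCharacter h𝔪 hv hw ⟨absGaloisRestrict K (v.adicCompletion K)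
          (WeilGroup.toAbsGalois (v.adicCompletion K) w'),
        absGaloisRestrict_toAbsGalois_mem_ker_rayClassField h𝔪 hv
          (isLocalArtinMap_canonicalArtin_holds (v.adicCompletion K)) hwI'⟩) :
    lubinTateChar hπ (WeilGroup.toAbsGalois (v.adicCompletion K) w) =
      lubinTateChar hπ (WeilGroup.toAbsGalois (v.adicCompletion K) w') := by
  apply (Units.map_injective (f := (integerEquivAdicCompletionIntegers v :
    𝒪[v.adicCompletion K] →* v.adicCompletionIntegers K)) (integerEquivAdicCompletionIntegers v).injective)
  rw [unitsMap_integerEquiv_lubinTateChar_eq_inv h𝔪 hv hw hπ hwI, unitsMap_integerEquiv_lubinTateChar_eq_inv h𝔪 hv hw hπ hwI', h]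

/-- `χ_π(w_{gh}) = χ_π(w_g)·χ_π(w_h)` (the lifts are multiplicative up to elements invisible to `χ_π`).
[cite: deShalit1987, I.1.8 (p. 11), II.1.10 Corollary (p. 39)] -/
theorem lubinTateChar_rayInertiaLift_mul (g h : ↥(absRestrictNormalHom (rayClassField K 𝔪)).ker) :
    lubinTateChar hπ (WeilGroup.toAbsGalois (v.adicCompletion K) (rayInertiaLift h𝔪 hv hw (g * h))) =
      lubinTateChar hπ (WeilGroup.toAbsGalois (v.adicCompletion K) (rayInertiaLift h𝔪 hv hw g)) *
        lubinTateChar hπ (WeilGroup.toAbsGalois (v.adicCompletion K) (rayInertiaLift h𝔪 hv hw h)) := by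
  have hmem : rayInertiaLift h𝔪 hv hw g * rayInertiaLift h𝔪 hv hw h ∈ WeilGroup.inertia (v.adicCompletion K) :=
    Subgroup.mul_mem _ (rayInertiaLift_mem_inertia h𝔪 hv hw g) (rayInertiaLift_mem_inertia h𝔪 hv hw h)
  rw [← lubinTateChar_mul, ← map_mul]
  refine lubinTateChar_eq_of_rayAdicCharacter_eq h𝔪 hv hw hπ (rayInertiaLift_mem_inertia h𝔪 hv hw (g * h)) hmem ?_
  have e : (⟨absGaloisRestrict K (v.adicCompletion K) (WeilGroup.toAbsGalois (v.adicCompletion K)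
        (rayInertiaLift h𝔪 hv hw g * rayInertiaLift h𝔪 hv hw h)),
      absGaloisRestrict_toAbsGalois_mem_ker_rayClassField h𝔪 hv
        (isLocalArtinMap_canonicalArtin_holds (v.adicCompletion K)) hmem⟩ :
        ↥(absRestrictNormalHom (rayClassField K 𝔪)).ker) =
      ⟨absGaloisRestrict K (v.adicCompletion K) (WeilGroup.toAbsGalois (v.adicCompletion K) (rayInertiaLift h𝔪 hv hw g)),
        absGaloisRestrict_toAbsGalois_mem_ker_rayClassField h𝔪 hv
          (isLocalArtinMap_canonicalArtin_holds (v.adicCompletion K)) (rayInertiaLift_mem_inertia h𝔪 hv hw g)⟩ *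
      ⟨absGaloisRestrict K (v.adicCompletion K) (WeilGroup.toAbsGalois (v.adicCompletion K) (rayInertiaLift h𝔪 hv hw h)),
        absGaloisRestrict_toAbsGalois_mem_ker_rayClassField h𝔪 hv
          (isLocalArtinMap_canonicalArtin_holds (v.adicCompletion K)) (rayInertiaLift_mem_inertia h𝔪 hv hw h)⟩ :=
    Subtype.ext (by
      change absGaloisRestrict K (v.adicCompletion K) (WeilGroup.toAbsGalois (v.adicCompletion K)
          (rayInertiaLift h𝔪 hv hw g * rayInertiaLift h𝔪 hv hw h)) =
        absGaloisRestrict K (v.adicCompletion K) (WeilGroup.toAbsGalois (v.adicCompletion K) (rayInertiaLift h𝔪 hv hw g)) *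
          absGaloisRestrict K (v.adicCompletion K) (WeilGroup.toAbsGalois (v.adicCompletion K) (rayInertiaLift h𝔪 hv hw h))
      rw [map_mul, map_mul])
  rw [rayAdicCharacter_rayInertiaLift, e, map_mul, map_mul, rayAdicCharacter_rayInertiaLift,
    rayAdicCharacter_rayInertiaLift]

/-- `χ_π(w_1) = 1`. [cite: deShalit1987, I.1.8 (p. 11), II.1.10 Corollary (p. 39)] -/
theorem lubinTateChar_rayInertiaLift_one :
    lubinTateChar hπ (WeilGroup.toAbsGalois (v.adicCompletion K)
      (rayInertiaLift h𝔪 hv hw (1 : ↥(absRestrictNormalHom (rayClassField K 𝔪)).ker))) = 1 := by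
  apply (Units.map_injective (f := (integerEquivAdicCompletionIntegers v :
    𝒪[v.adicCompletion K] →* v.adicCompletionIntegers K)) (integerEquivAdicCompletionIntegers v).injective)
  rw [unitsMap_integerEquiv_lubinTateChar_eq_inv h𝔪 hv hw hπ (rayInertiaLift_mem_inertia h𝔪 hv hw 1),
    rayAdicCharacter_rayInertiaLift, map_one, map_one, inv_one]

/-! ### §2. The `CommMonoid` structure and the `κ_v`-action on `RelNormCoherentUnits hπ E` -/

variable (E : IntermediateField (v.adicCompletion K) (AlgebraicClosure (v.adicCompletion K)))
  [FiniteDimensional (v.adicCompletion K) E] [Normal (v.adicCompletion K) E] (hE : E ≤ maxUnramified (v.adicCompletion K))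

/-- The termwise product makes the relative norm-coherent units a commutative monoid (structure-carrying `def`, enabled
section-locally; `*` is `RelNormCoherentUnits.mul`, `1` is `RelNormCoherentUnits.one`). [cite: deShalit1987, I.2.3 (i) (p. 14)] -/
@[reducible] def _root_.Literature.NumberTheory.GaloisRepresentations.RelNormCoherentUnits.instCommMonoid
    {F : Type} [Field F] [ValuativeRel F] [TopologicalSpace F] [IsNonarchimedeanLocalField F]
    {π' : 𝒪[F]} (hπ' : (valuation F).IsUniformizer (π' : F))
    (E' : IntermediateField F (AlgebraicClosure F)) [FiniteDimensional F E'] :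
    CommMonoid (RelNormCoherentUnits hπ' E') where
  mul := RelNormCoherentUnits.mul
  one := RelNormCoherentUnits.one
  mul_assoc a b c := RelNormCoherentUnits.ext fun m => mul_assoc _ _ _
  one_mul a := RelNormCoherentUnits.ext fun m => one_mul _
  mul_one a := RelNormCoherentUnits.ext fun m => mul_one _
  mul_comm a b := RelNormCoherentUnits.ext fun m => mul_comm _ _

attribute [local instance] RelNormCoherentUnits.instCommMonoid

/-- ★ **The `κ_v`-action `g • β := w_g · β`** of `G = Gal(K̄/K(𝔪))` on the `𝔓`-adic norm-coherent units: well defined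
and an action because `w·β` depends only on `χ_π(w)` for `w` fixing `E` (`galAct_congr`), the lifts fix `E ≤ K_v^{nr}`
(`smul_coe_eq_of_mem_inertia`) and `χ_π(w_{gh}) = χ_π(w_g)χ_π(w_h)`; it distributes over products (`galAct_mul`).
This is de Shalit's `𝒢 ⊇ G`-module structure of `𝒰_𝔓` (II.4.5) restricted to `G`. [cite: deShalit1987, II.4.5 (p. 58), I.2.3 (iv) (p. 14), II.1.10 Corollary (p. 39)] -/
@[reducible] def rayAction : MulDistribMulAction ↥(absRestrictNormalHom (rayClassField K 𝔪)).ker (RelNormCoherentUnits hπ E) where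
  smul g β := β.galAct (WeilGroup.toAbsGalois (v.adicCompletion K) (rayInertiaLift h𝔪 hv hw g))
  one_smul β := RelNormCoherentUnits.galAct_eq_self β
    (smul_coe_eq_of_mem_inertia v (rayInertiaLift_mem_inertia h𝔪 hv hw 1) hE)
    (lubinTateChar_rayInertiaLift_one h𝔪 hv hw hπ)
  mul_smul g h β := by
    change β.galAct (WeilGroup.toAbsGalois (v.adicCompletion K) (rayInertiaLift h𝔪 hv hw (g * h))) =
      (β.galAct (WeilGroup.toAbsGalois (v.adicCompletion K) (rayInertiaLift h𝔪 hv hw h))).galAct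
        (WeilGroup.toAbsGalois (v.adicCompletion K) (rayInertiaLift h𝔪 hv hw g))
    rw [RelNormCoherentUnits.galAct_mul_left, ← map_mul]
    refine RelNormCoherentUnits.galAct_congr β
      (smul_coe_eq_of_mem_inertia v (rayInertiaLift_mem_inertia h𝔪 hv hw (g * h)) hE)
      (smul_coe_eq_of_mem_inertia v (Subgroup.mul_mem _ (rayInertiaLift_mem_inertia h𝔪 hv hw g)
        (rayInertiaLift_mem_inertia h𝔪 hv hw h)) hE) ?_
    rw [lubinTateChar_rayInertiaLift_mul h𝔪 hv hw hπ, map_mul, lubinTateChar_mul]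
  smul_mul g β β' := RelNormCoherentUnits.galAct_mul _ β β'
  smul_one g := RelNormCoherentUnits.galAct_one_right' _

/-- Unfolding of the action. [cite: deShalit1987, II.4.5 (p. 58)] -/
theorem rayAction_smul_def (g : ↥(absRestrictNormalHom (rayClassField K 𝔪)).ker) (β : RelNormCoherentUnits hπ E) :
    letI := rayAction h𝔪 hv hw hπ E hE
    g • β = β.galAct (WeilGroup.toAbsGalois (v.adicCompletion K) (rayInertiaLift h𝔪 hv hw g)) := rfl

/-! ### §3. The dictionary and the series-family hypotheses `hη` / `hgal` for the `𝔓`-adic units -/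

variable {E}

include hE in
/-- ★ **One matching inertia element per `(g, b)` gives the full dictionary** of `PAdicOneVariableSeriesFamilyRelSupply`
(`galAct_congr` + the units junction): for any `G`-set `B` and `η : B → 𝒰_𝔓`.
[cite: deShalit1987, II.1.10 Corollary (p. 39), I.2.3 (iv) (p. 14)] -/
theorem hdict_of_exists {B : Type*}
    [SMul (↥(absRestrictNormalHom (rayClassField K 𝔪)).ker) B] (η : B → RelNormCoherentUnits hπ E)
    {g : ↥(absRestrictNormalHom (rayClassField K 𝔪)).ker} {b : B}
    (h : ∃ (w₀ : WeilGroup (v.adicCompletion K)) (hw₀ : w₀ ∈ WeilGroup.inertia (v.adicCompletion K)),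
      rayAdicCharacter h𝔪 hv hw ⟨absGaloisRestrict K (v.adicCompletion K)
          (WeilGroup.toAbsGalois (v.adicCompletion K) w₀),
        absGaloisRestrict_toAbsGalois_mem_ker_rayClassField h𝔪 hv
          (isLocalArtinMap_canonicalArtin_holds (v.adicCompletion K)) hw₀⟩ = rayAdicCharacter h𝔪 hv hw g ∧
      η (g • b) = (η b).galAct (WeilGroup.toAbsGalois (v.adicCompletion K) w₀))
    (w : WeilGroup (v.adicCompletion K)) (hwI : w ∈ WeilGroup.inertia (v.adicCompletion K))
    (hκ : rayAdicCharacter h𝔪 hv hw ⟨absGaloisRestrict K (v.adicCompletion K)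
          (WeilGroup.toAbsGalois (v.adicCompletion K) w),
        absGaloisRestrict_toAbsGalois_mem_ker_rayClassField h𝔪 hv
          (isLocalArtinMap_canonicalArtin_holds (v.adicCompletion K)) hwI⟩ = rayAdicCharacter h𝔪 hv hw g) :
    η (g • b) = (η b).galAct (WeilGroup.toAbsGalois (v.adicCompletion K) w) := by
  obtain ⟨w₀, hw₀, hκ₀, hη₀⟩ := h
  rw [hη₀]
  exact RelNormCoherentUnits.galAct_congr _ (smul_coe_eq_of_mem_inertia v hw₀ hE) (smul_coe_eq_of_mem_inertia v hwI hE)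
    (lubinTateChar_eq_of_rayAdicCharacter_eq h𝔪 hv hw hπ hw₀ hwI (hκ₀.trans hκ.symm))

/-- ★ **The dictionary holds BY CONSTRUCTION for `B := 𝒰_𝔓` with the `κ_v`-action and `η := id`.**
[cite: deShalit1987, II.4.5 (p. 58), II.1.10 Corollary (p. 39)] -/
theorem hdict_rayAction {𝒰 : SubgroupTower ↥(absRestrictNormalHom (rayClassField K 𝔪)).ker} :
    letI := rayAction h𝔪 hv hw hπ E hE
    ∀ g ∈ 𝒰.U 0, ∀ b : RelNormCoherentUnits hπ E, ∀ (w : WeilGroup (v.adicCompletion K))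
      (hwI : w ∈ WeilGroup.inertia (v.adicCompletion K)),
      rayAdicCharacter h𝔪 hv hw ⟨absGaloisRestrict K (v.adicCompletion K)
          (WeilGroup.toAbsGalois (v.adicCompletion K) w),
        absGaloisRestrict_toAbsGalois_mem_ker_rayClassField h𝔪 hv
          (isLocalArtinMap_canonicalArtin_holds (v.adicCompletion K)) hwI⟩ = rayAdicCharacter h𝔪 hv hw g →
      (fun β : RelNormCoherentUnits hπ E ↦ β) (g • b) = (b).galAct (WeilGroup.toAbsGalois (v.adicCompletion K) w) := by
  letI := rayAction h𝔪 hv hw hπ E hE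
  intro g _ b w hwI hκ
  exact hdict_of_exists h𝔪 hv hw hπ hE (η := fun β : RelNormCoherentUnits hπ E ↦ β)
    ⟨rayInertiaLift h𝔪 hv hw g, rayInertiaLift_mem_inertia h𝔪 hv hw g, rayAdicCharacter_rayInertiaLift h𝔪 hv hw g, rfl⟩
    w hwI hκ

/-! ### §4. `hadd` / `hη` / `hgal` of the series-family package for `B := 𝒰_𝔓` with the `κ_v`-action (`η := id`) -/

variable (h2 : (valuation (v.adicCompletion K)).IsUniformizer (((2 : ℕ) : 𝒪[v.adicCompletion K]) : v.adicCompletion K))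
  (u : 𝒪[v.adicCompletion K]ˣ) [IsGalois (v.adicCompletion K) E]
  (hq : residueFieldCard (v.adicCompletion K) = 2)
  {σ₀ : absoluteGaloisGroup (v.adicCompletion K)} (hσ₀ : IsAbsArithFrob σ₀) (uL : LTCoeff (v.adicCompletion K))
  (j : unitBall E →+* UnrCoeff (v.adicCompletion K))
  (hj : j.comp (algebraMap (LTCoeff (v.adicCompletion K)) (unitBall E)) =
    (intToUnrCoeff (v.adicCompletion K)).comp (LTCoeff.of (v.adicCompletion K)).symm.toRingHom)
  (e : 𝒪[v.adicCompletion K] →+* ℤ_[2])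
  {𝒰 : SubgroupTower ↥(absRestrictNormalHom (rayClassField K 𝔪)).ker}
  (κ : ↥(absRestrictNormalHom (rayClassField K 𝔪)).ker →* ℤ_[2]ˣ)
  (hκ : ∀ g, κ g = (Units.map ((e.comp (integerEquivAdicCompletionIntegers v).symm.toRingHom :
      v.adicCompletionIntegers K →+* ℤ_[2]) : v.adicCompletionIntegers K →* ℤ_[2]) (rayAdicCharacter h𝔪 hv hw g))⁻¹)

omit [IsTotallyComplex K] in
/-- ★ **`hadd` for `B := 𝒰_𝔓`, `η := id`**: `j((δ g_{ββ'})~) = j((δ g_β)~) + j((δ g_{β'})~)` for the monoid product.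
[cite: deShalit1987, I.3.4 Lemma (i) (p. 18)] -/
theorem seriesFamily_hadd_rayUnits (b b' : RelNormCoherentUnits (isUniformizer_unit_mul h2 u) E) :
    (relTildeSeries (isUniformizer_unit_mul h2 u) E hq hE hσ₀ uL (b * b')).map j =
      (relTildeSeries (isUniformizer_unit_mul h2 u) E hq hE hσ₀ uL b).map j +
        (relTildeSeries (isUniformizer_unit_mul h2 u) E hq hE hσ₀ uL b').map j :=
  map_relTildeSeries_mul h2 u E hq hE hσ₀ uL j b b'

omit [IsGalois (v.adicCompletion K) E] in
include hκ in
/-- ★ **`hη` for `B := 𝒰_𝔓` with the `κ_v`-action, `η := id`, `κ := ((e ∘ §1⁻¹) ∘ κ_v)⁻¹` — NO dictionary hypothesis.**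
[cite: deShalit1987, II.4.5–4.6 (p. 58–59), II.1.10 Corollary (p. 39), I.3.4 Lemma (ii) (p. 18)] -/
theorem seriesFamily_hη_rayAction :
    letI := rayAction h𝔪 hv hw (isUniformizer_unit_mul h2 u) E hE
    ∀ g ∈ 𝒰.U 0, ∀ b : RelNormCoherentUnits (isUniformizer_unit_mul h2 u) E,
      ∃ σ : absoluteGaloisGroup (v.adicCompletion K),
        (∀ x : E, σ • (x : AlgebraicClosure (v.adicCompletion K)) = x) ∧ g • b = b.galAct σ ∧
        Units.map (e : 𝒪[v.adicCompletion K] →* ℤ_[2]) (lubinTateChar (isUniformizer_unit_mul h2 u) σ) = κ g := by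
  letI := rayAction h𝔪 hv hw (isUniformizer_unit_mul h2 u) E hE
  exact seriesFamily_hη_of_dictionary h𝔪 hv hw h2 u E hE e κ hκ (fun β : RelNormCoherentUnits _ E ↦ β)
    (hdict_rayAction h𝔪 hv hw (isUniformizer_unit_mul h2 u) hE)

include hκ hj in
/-- ★ **`hgal` for `B := 𝒰_𝔓` with the `κ_v`-action VERBATIM** (`φ β := j((δ_E g_β)~)`, `κ := ((e ∘ §1⁻¹) ∘ κ_v)⁻¹`) — together
with `seriesFamily_hadd_rayUnits` and `seriesFamily_hsock_of_relNormCoherentUnits` ALL hypotheses of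
`PAdicOneVariableSeriesFamily{OfCharacter, MomentsOfCharacter, GlueOfCharacter}` hold for the `𝔓`-adic norm-coherent units
with their natural `Gal(K̄/K(𝔪))`-action. [cite: deShalit1987, I.3.4 Lemma (ii) (p. 18), II.4.6 (14) (p. 59), II.1.10 Corollary (p. 39)] -/
theorem seriesFamily_hgal_rayAction :
    letI := rayAction h𝔪 hv hw (isUniformizer_unit_mul h2 u) E hE
    ∀ g ∈ 𝒰.U 0, ∀ b : RelNormCoherentUnits (isUniformizer_unit_mul h2 u) E, ∃ a : 𝒪[v.adicCompletion K],
      (κ g : ℤ_[2]) = e a ∧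
      (relTildeSeries (isUniformizer_unit_mul h2 u) E hq hE hσ₀ uL (g • b)).map j =
        PowerSeries.C (intToUnrCoeff (v.adicCompletion K) a) * PowerSeries.subst (homC' h2 u a)
          ((relTildeSeries (isUniformizer_unit_mul h2 u) E hq hE hσ₀ uL b).map j) := by
  letI := rayAction h𝔪 hv hw (isUniformizer_unit_mul h2 u) E hE
  exact seriesFamily_hgal_of_dictionary h𝔪 hv hw h2 u E hq hE hσ₀ uL j hj e κ hκ (fun β : RelNormCoherentUnits _ E ↦ β)
    (hdict_rayAction h𝔪 hv hw (isUniformizer_unit_mul h2 u) hE)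

end RayAction

end Literature.NumberTheory.EllipticCurves

end
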